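/-
Origin: expansion seat `planner-pub-hodgecm-pv13-0`, handover 2026-08-18 (`HOME/pub-hodgecm-pv13/lean/Pv13/Li92Constituents.lean`, md5 641992e8, 83 lines);
landed by the gen-6 packager in gate run 22 as `HodgeCM/PerL34/Li92Constituents.lean` (verbatim).
-/
/-
Origin: pub-hodgecm-pv13 (DAG-NODE PROVER #13) — the Hilbert-space content of the PRINT re-sourcing of tex l. 634
(GAPS.md pv13 addendum 13): [Li92] J.-S. Li, Crelle 428 (1992), **Cor. 5.5 + Thm. 5.4 a), p. 206** (page-verified):
in the stable range the full theta-lift space `V(θ, χ')` "affords an IRREDUCIBLE unitary representation σ = ⊗σ_v of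
G(𝔸)" with `σ_v` the local Howe lift at every place.  Consequence used by PerL ll. 633–635: PerL's `π_i ⊆ V(θ,χ'_i)`
is non-zero [N31h (i), kernel], so the closure of `π_i` IS the closure of `V(θ,χ'_i)` and has exactly ONE irreducible
constituent — itself.  Imports the landed `HodgeCM.PerL34.SchurUnitary` only.  Proposed place:
`HodgeCM/PerL34/Li92Constituents.lean`, namespace `HodgeCM.PerL34.Schur`.  Nothing cited as a Lean axiom; the Li92
sentence enters only as the HYPOTHESIS `hKirr` below.
-/
import Summits.HodgeConjecture.HodgeCM.PerL34.SchurUnitary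

set_option autoImplicit false

/-!
# One constituent: a non-zero invariant subspace of an irreducible closed invariant subspace

* `closure_eq_of_irreducible_ambient` — KERNEL: `S` a set of bounded operators on a Hilbert space `H`, `K` a closed
  `S`-invariant subspace which is IRREDUCIBLE (its only closed invariant subspaces are `⊥` and `K` — Li92 Cor 5.5 for
  `K = closure V(θ,χ')`), `Θ ⊆ K` a set of vectors whose span `π` is `S`-invariant and non-zero (PerL's `π_i`,
  non-zero by N31h (i)).  Then `closure π = K`.
* `constituent_eq_of_irreducible_ambient` — KERNEL: every non-zero closed invariant `K' ≤ closure π` equals `K`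
  ("every irreducible constituent of the closure of `π_i`" is `σ` itself); so its archimedean component is `σ_∞ =
  ⊗_b H(χ'_b*)` [Li92 Cor 5.5, third sentence] `= J⁺ ⊠ 1^⊗` [PerL L4.2(a) = (r1)] — no Schur-type argument is needed on
  this route; `ConstituentSplit`/`ConstituentCore` remain the carrier when irreducibility of `V(θ,χ')` is not invoked.
-/

noncomputable section

namespace HodgeCM
namespace PerL34
namespace Schur

variable {H : Type*} [NormedAddCommGroup H] [InnerProductSpace ℂ H]

/-- Invariance of a span passes to its topological closure (bounded operators). -/
theorem invariant_topologicalClosure (S : Set (H →L[ℂ] H)) (P : Submodule ℂ H) (hP : Invariant S P) :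
    Invariant S P.topologicalClosure := by
  intro s hs x hx
  have hx' : x ∈ closure (P : Set H) := by
    rw [← Submodule.topologicalClosure_coe]; exact hx
  have : s x ∈ closure (P : Set H) := by
    have hmaps : Set.MapsTo s (P : Set H) (P : Set H) := fun y hy => hP s hs y hy
    exact (hmaps.closure s.continuous) hx'
  show s x ∈ (P.topologicalClosure : Set H)
  rw [Submodule.topologicalClosure_coe]; exact this

/-- **KERNEL.** A non-zero invariant subspace `π` of an irreducible closed invariant subspace `K` is dense in `K`:
`closure π = K`. -/
theorem closure_eq_of_irreducible_ambient (S : Set (H →L[ℂ] H)) (K : Submodule ℂ H) (hKc : IsClosed (K : Set H))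
    (hKirr : ∀ K' : Submodule ℂ H, K' ≤ K → IsClosed (K' : Set H) → Invariant S K' → K' = ⊥ ∨ K' = K)
    (π : Submodule ℂ H) (hπK : π ≤ K) (hπinv : Invariant S π) (hπ : π ≠ ⊥) :
    π.topologicalClosure = K := by
  have hle : π.topologicalClosure ≤ K := Submodule.topologicalClosure_minimal π hπK hKc
  rcases hKirr π.topologicalClosure hle (Submodule.isClosed_topologicalClosure π)
      (invariant_topologicalClosure S π hπinv) with h | h
  · exact absurd (le_bot_iff.mp (h ▸ π.le_topologicalClosure)) hπ
  · exact h

/-- **KERNEL.** Hence every non-zero closed invariant subspace of `closure π` (every "irreducible constituent of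
the closure of `π_i`") is `K` itself. -/
theorem constituent_eq_of_irreducible_ambient (S : Set (H →L[ℂ] H)) (K : Submodule ℂ H)
    (hKc : IsClosed (K : Set H))
    (hKirr : ∀ K' : Submodule ℂ H, K' ≤ K → IsClosed (K' : Set H) → Invariant S K' → K' = ⊥ ∨ K' = K)
    (π : Submodule ℂ H) (hπK : π ≤ K) (hπinv : Invariant S π) (hπ : π ≠ ⊥)
    (K' : Submodule ℂ H) (hK'le : K' ≤ π.topologicalClosure) (hK'c : IsClosed (K' : Set H))
    (hK'inv : Invariant S K') (hK' : K' ≠ ⊥) : K' = K := by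
  have hcl := closure_eq_of_irreducible_ambient S K hKc hKirr π hπK hπinv hπ
  rcases hKirr K' (hcl ▸ hK'le) hK'c hK'inv with h | h
  · exact absurd h hK'
  · exact h

/-- The span of a set of vectors containing a non-zero vector is non-zero (the shape in which N31h (i) —
`θ_φ(χ') ≠ 0`, `θ_φ(χ') ∈ Θ` — feeds `hπ` above). -/
theorem span_ne_bot_of_mem {Θ : Set H} {θ : H} (hθ : θ ∈ Θ) (hθ0 : θ ≠ 0) : Submodule.span ℂ Θ ≠ ⊥ := by
  intro h
  exact hθ0 ((Submodule.span_eq_bot.mp h) θ hθ)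

end Schur
end PerL34
end HodgeCM

end
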